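import Literature.NumberTheory.EllipticCurves.IsogenyFaltingsTraceKor2Proofs
import Literature.NumberTheory.EllipticCurves.IsogenyFaltingsTraceEquivProofs
import Literature.AlgebraicGeometry.Motives.FaltingsECHomFrontierProofs
import HarnessLib

/-!
# Faltings' isogeny theorem for elliptic curves over `ℚ` via `a_p`: Finiteness I is all that remains

Sibling proof file (theorems only; no definition, statement, instance or named fact) of
`Literature.NumberTheory.EllipticCurves.Isogeny`, serving its named fact
`WeierstrassCurve.isIsogenous_iff_frobeniusTrace_eq`: two globally minimal elliptic curves over
`ℚ` are `ℚ`-isogenous iff `a_p(E) = a_p(E')` for all but finitely many primes `p` — G. Faltings,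
*Endlichkeitssätze für abelsche Varietäten über Zahlkörpern*, Invent. Math. **73** (1983),
349–366, §5, Korollar 2, (i) ⇔ (iii) (English translation: Cornell–Silverman (eds.), *Arithmetic
Geometry*, Springer 1986, Ch. II, §5, Corollary 2, held copy `book:cornellnd-arithmetic-geometry`,
PDF p. 90, read: "(i) ⇔ (ii) follow from Theorem 4, (ii) ⇔ (iii) from Theorem 3", with Čebotarev).

## Status of the tree's formalisation of the printed proof (2026-08-15)

* (i) ⇒ (iii) is the theorem `finite_setOf_frobeniusTrace_ne_of_isIsogenous`
  (`IsogenyFrobeniusTraceProofs`).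
* (ii) ⇔ (iii) is unconditional (`IsogenyFaltingsTraceEquivProofs`): Satz 3 (semisimplicity of
  `V_ℓ E`) is the theorem `isSemisimpleRepresentation_rationalGaloisRepTate_holds`, Čebotarev is
  replaced by Frobenius' density theorem, Brauer–Nesbitt in characteristic `0` is proved.
* (iii) ⇒ (i) is Korollar 2, (ii) ⇒ (i), for the pair at one prime `ℓ` — Faltings' isogeny
  theorem in Tate-module form (`isIsogenous_iff_exists_tateModule_hom_ne_zero W W' ℓ`). The tree
  derives it by Tate's graph argument on the abelian surface `A ⊞ A'` bridged from `E, E'`; of the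
  three inputs of that argument two are now theorems — the bridge "elliptic curves are abelian
  varieties" (`nonempty_abelianVarietyBridgeFull_holds`, *AEC* III.3.6, III.4.8–4.9) and the
  quotient of an abelian variety by a finite `Γ_K`-stable subgroup with the factorisation of `[ℓⁿ]`
  (`AbelianVariety.exists_quotient_isogeny_holds`, `TateAbelianFiniteLatticeProofs`; Mumford,
  *Abelian Varieties*, §7 Thm. 4; Kieffer 2024, Prop. 1.1.10, 1.1.12–1.1.13) — so that Korollar 2
  for a pair over any number field follows from Faltings' **Finiteness I** alone:
  `isIsogenous_iff_exists_tateModule_hom_ne_zero_of_forall_finitenessI`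
  (`FaltingsECHomFrontierProofs`, §(D)).

Composing, this file records that the named fact `isIsogenous_iff_frobeniusTrace_eq` follows from
exactly **one** remaining named fact, Faltings' Finiteness I over `ℚ`
(`AbelianVariety.finite_isoClasses_isogenous P` for the abelian varieties `P` over `ℚ`: up to
`ℚ`-isomorphism only finitely many abelian varieties over `ℚ` are `ℚ`-isogenous to `P`; §6 Satz 6
with Zarhin's trick; Milne, *Abelian Varieties*, IV Thm. 1.1; the proof consumes it only for the
bridged surfaces `A ⊞ A'`). Finiteness I is Faltings' theorem proper (heights on the moduli space,
`p`-divisible groups, Hodge–Tate weights, Raynaud's theorem on group schemes of type `(p, …, p)`),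
the one deep input of the printed proof; it is not in Mathlib or the tree, no new named fact is
introduced here (D-0026), and `isIsogenous_iff_frobeniusTrace_eq_holds` is **not** asserted: it is
the one-liner
`isIsogenous_iff_frobeniusTrace_eq_of_forall_finitenessI (fun P ↦ finite_isoClasses_isogenous_holds P)`
the moment Finiteness I over `ℚ` is discharged. It supersedes the two-hypothesis assembly
`isIsogenous_iff_frobeniusTrace_eq_of_finitenessI_quotient` (`IsogenyFaltingsTraceFinitenessIProofs`).

## Contents (all proved; compositions of the tree's reductions)

* `WeierstrassCurve.isIsogenous_iff_finite_setOf_frobeniusTrace_ne_of_forall_finitenessI`: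
  Korollar 2, (i) ⇔ (iii), for one pair of globally minimal elliptic curves over `ℚ`, from
  Finiteness I over `ℚ` (Korollar 2 for that pair invoked at an arbitrary prime `ℓ`).
* `WeierstrassCurve.isIsogenous_iff_frobeniusTrace_eq_of_forall_finitenessI`: the named fact from
  Finiteness I over `ℚ` alone (auxiliary prime `ℓ = 2`).

## References

* [Faltings1983Endlichkeit] G. Faltings, Invent. Math. 73 (1983), 349–366, §5 Sätze 3–4,
  Korollar 1, Korollar 2; §6 Satz 6. doi:10.1007/bf01388432.
* [Faltings1986FinitenessTranslation] English translation, Cornell–Silverman (eds.), *Arithmetic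
  Geometry*, Springer 1986, Ch. II, §5 Theorems 3–4, Corollaries 1–2; §6 Theorem 6 (held:
  `book:cornellnd-arithmetic-geometry`, PDF pp. 89–92; read).
* [MilneAV2008] J. S. Milne, *Abelian Varieties* (2008), Ch. IV, Thm. 1.1 (Finiteness I),
  Lemma 2.4, Thm. 2.5, Cor. 2.6.
* [Tate1966Endomorphisms] J. Tate, Invent. Math. 2 (1966), 134–144, §2.
* [SilvermanAEC2009] J. H. Silverman, *The Arithmetic of Elliptic Curves*, 2nd ed., III.3.6,
  III.4.8–4.9, III.7.4, III.7.7, C.16.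

## Design choices

Theorems only (a pure proof file); `noncomputable section`; Finiteness I quantified over all
abelian varieties over `ℚ` exactly as in `FaltingsECHomFrontierProofs` §(D); the auxiliary prime
is explicit in the pair statement and fixed to `ℓ = 2` (`Nat.fact_prime_two`) in the final
assembly. Deliberate dot-notation extensions of Mathlib's `WeierstrassCurve` namespace next to the
assemblies they refine.
-/

noncomputable section

namespace WeierstrassCurve

open Literature.AlgebraicGeometry.Motives

/-- **Faltings' Korollar 2, (i) ⇔ (iii), for one pair over `ℚ`, from Finiteness I over `ℚ`.**
For globally minimal elliptic curves `W, W'` over `ℚ`: granted Finiteness I for the abelian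
varieties over `ℚ` (`AbelianVariety.finite_isoClasses_isogenous`), `W ~_ℚ W'` iff
`a_p(W) = a_p(W')` for all but finitely many primes `p`. Korollar 2 in Tate-module form for the
pair is `isIsogenous_iff_exists_tateModule_hom_ne_zero_of_forall_finitenessI W W' ℓ hfin` (Tate's
graph argument on `A ⊞ A'`, bridge and quotients being theorems), at an arbitrary prime `ℓ`; the
equivalence with (iii) is `isIsogenous_iff_finite_setOf_frobeniusTrace_ne_of_kor2`
(`IsogenyFaltingsTraceEquivProofs`: Satz 3, Frobenius density, Brauer–Nesbitt, all proved).
[cite: Faltings1983Endlichkeit, §5 Korollar 2, (i) ⇔ (iii), with §6 Satz 6] -/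
theorem isIsogenous_iff_finite_setOf_frobeniusTrace_ne_of_forall_finitenessI
    (ℓ : ℕ) [Fact ℓ.Prime] {W W' : WeierstrassCurve ℚ} [W.IsElliptic] [W'.IsElliptic]
    [W.IsGloballyMinimal] [W'.IsGloballyMinimal]
    (hfin : ∀ P : AbelianVariety ℚ, AbelianVariety.finite_isoClasses_isogenous P) :
    IsIsogenous W W' ↔ {p : ℕ | p.Prime ∧ W.frobeniusTrace p ≠ W'.frobeniusTrace p}.Finite :=
  isIsogenous_iff_finite_setOf_frobeniusTrace_ne_of_kor2 ℓ W W'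
    (isIsogenous_iff_exists_tateModule_hom_ne_zero_of_forall_finitenessI W W' ℓ hfin)

/-- **Faltings' isogeny theorem over `ℚ` via `a_p`, from Finiteness I over `ℚ` alone.** Granted,
for every abelian variety `P` over `ℚ`, Faltings' Finiteness I (`finite_isoClasses_isogenous P`:
up to isomorphism only finitely many abelian varieties over `ℚ` are isogenous to `P`; Faltings
1983, §6 Satz 6 with Zarhin's trick; Milne *AV* IV Thm. 1.1), two globally minimal elliptic
curves over `ℚ` are `ℚ`-isogenous iff `a_p(W) = a_p(W')` for all but finitely many primes `p`
(Faltings 1983, §5 Korollar 2, (i) ⇔ (iii)). Proof: `isIsogenous_iff_frobeniusTrace_eq_of_kor2`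
at the auxiliary prime `ℓ = 2` with Korollar 2 for every pair over `ℚ` from
`isIsogenous_iff_exists_tateModule_hom_ne_zero_of_forall_finitenessI`. With a discharge
`finite_isoClasses_isogenous_holds` over `ℚ` this term is `isIsogenous_iff_frobeniusTrace_eq_holds`.
[cite: Faltings1983Endlichkeit, §5 Korollar 2, (i) ⇔ (iii), with §6 Satz 6] -/
theorem isIsogenous_iff_frobeniusTrace_eq_of_forall_finitenessI
    (hfin : ∀ P : AbelianVariety ℚ, AbelianVariety.finite_isoClasses_isogenous P) :
    isIsogenous_iff_frobeniusTrace_eq :=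
  isIsogenous_iff_frobeniusTrace_eq_of_kor2 2 fun W W' ↦
    isIsogenous_iff_exists_tateModule_hom_ne_zero_of_forall_finitenessI W W' 2 hfin

end WeierstrassCurve

end
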